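import Mathlib
import Summits.Ventures.PercRepro2.CoinTreeCore
import Summits.Ventures.PercRepro2.CoinOrTailKDefs
import Summits.Ventures.PercRepro2.CoinK2HeadBlindCore
import Summits.Ventures.PercRepro2.CoinK2HeadBlindArcs

/-!
# Two incomparable uncovered entries: an instantiation check
(blind cell PercRepro2, night-2 g12; NIGHT2-DARC.md §47.6)

A concrete coin system on `Fin 8` (s = 0, m₁ = 1, m₂ = 2, r₁ = 3, r₂ = 4, a = 5, w = 6, t = 7):
the four branches `s → m₁`, `s → m₂`, `s → r₁`, `s → r₂` of an out-tree core, the two SURE tail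
arcs `r₁ → a`, `r₂ → a` (coins 4 and 5, of probability 1), and the head coins `a → t`, `w → t`,
`r₁ → t`, `r₂ → w` — the core's only exits into the head are through the two entries, which are
dominated by NEITHER marker and have INCOMPARABLE traces.  `OrTailK`, `TreeCore` and the exit
condition hold by `decide`; `darc_of_orTailTreeK2HeadBlind` gives row 2′DARC at `a → w` for the
markers `m₁, m₂` and every probability vector with sure tail coins for which the head can be
avoided from `{r₁, r₂, a, w}` with positive probability (`hpos` — true whenever the four head
coins have probability `< 1`; stated as a hypothesis here).
-/

namespace Summit.Ventures.PercRepro2.Coin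

namespace K2HeadBlindExample

open Classical

/-- The ten coins of the example. -/
def arcsEx : Fin 10 → Finset (Fin 8 × Fin 8)
  | 0 => {(0, 1)}   -- s → m₁
  | 1 => {(0, 2)}   -- s → m₂
  | 2 => {(0, 3)}   -- s → r₁
  | 3 => {(0, 4)}   -- s → r₂
  | 4 => {(3, 5)}   -- r₁ → a  (sure)
  | 5 => {(4, 5)}   -- r₂ → a  (sure)
  | 6 => {(5, 7)}   -- a → t
  | 7 => {(6, 7)}   -- w → t
  | 8 => {(3, 7)}   -- r₁ → t
  | 9 => {(4, 6)}   -- r₂ → w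

/-- The entry coins: `c r₁ = 4`, `c r₂ = 5`. -/
def cEx : Fin 8 → Fin 10
  | 3 => 4
  | 4 => 5
  | _ => 0

/-- The tree coins. -/
def tcEx : Fin 8 → Fin 10
  | 1 => 0
  | 2 => 1
  | 3 => 2
  | 4 => 3
  | _ => 0

/-- The parent map (every core vertex is a child of `s`). -/
def parEx : Fin 8 → Fin 8 := fun _ => 0

/-- The rank. -/
def rkEx : Fin 8 → ℕ
  | 1 => 1
  | 2 => 1
  | 3 => 1
  | 4 => 1
  | _ => 0

/-- Every coin is a single arc, so `SameEnds` holds. -/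
lemma sameEnds_ex : SameEnds arcsEx := by
  intro e xy hxy x'y' hx'y'
  fin_cases e <;> simp [arcsEx] at hxy hx'y' <;> subst hxy <;> subst hx'y' <;>
    exact ⟨Or.inl rfl, Or.inr rfl⟩

/-- `{m₁, m₂, r₁, r₂}` is an out-tree core of `s`. -/
lemma treeCore_ex : TreeCore arcsEx 0 {1, 2, 3, 4} tcEx parEx rkEx where
  tree := by decide
  par_mem := by decide
  rank := by decide
  into_C := by decide
  into_s := by decide
  s_notin := by decide

/-- The core with the tail `a = 5` entered from `r₁, r₂` is a two-entry OR-tail. -/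
lemma orTailK_ex : OrTailK arcsEx 0 {1, 2, 3, 4} {3, 4} cEx 5 where
  ent_sub := by decide
  s_notin := by decide
  a_notin := by decide
  a_ne_s := by decide
  into_U := by decide
  into_s := by decide
  into_a := by decide
  arcs_c := by decide
  c_inj := by decide

/-- **Row 2′DARC at the arc `a → w` for the markers `m₁, m₂` with the two uncovered entries
`r₁, r₂` (sure coins `4`, `5`) of incomparable traces, for every probability vector with the head
avoidable from `{r₁, r₂, a, w}`.** -/
theorem darc_k2HeadBlind_example {R : Type*} [Field R] [LinearOrder R] [IsStrictOrderedRing R]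
    (pr : Fin 10 → R) (hp : IsProbVec pr) (h4 : pr 4 = 1) (h5 : pr 5 = 1)
    (hpos : 0 < prob pr (coreAvoidEvent arcsEx 0 7 (insert 5 {1, 2, 3, 4}) ({3, 4} ∪ {5, 6}))) :
    DARC pr arcsEx 0 {7} 1 2 5 6 :=
  darc_of_orTailTreeK2HeadBlind pr hp sameEnds_ex orTailK_ex treeCore_ex (by decide) (by decide)
    (r₁ := 3) (r₂ := 4) (by decide) (by decide) (by decide)
    (by
      intro r hr
      fin_cases hr
      · exact h4
      · exact h5)
    (by decide) (by decide) (by decide) (by decide) (by decide) hpos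

/-- The index map of the four head coins (`5 ↦ a → t`, `6 ↦ w → t`, `7 ↦ r₁ → t`, `0 ↦ r₂ → w`). -/
def hcEx : Fin 8 → Fin 10
  | 5 => 6
  | 6 => 7
  | 7 => 8
  | 0 => 9
  | _ => 0

/-- Every coin with an arc into the core `{m₁, m₂, r₁, r₂, a}` is a core coin: coins `0`–`5`. -/
lemma coreCoins_ex (e : Fin 10) (he : e ∈ ({0, 1, 2, 3, 4, 5} : Finset (Fin 10))) :
    e ∈ coreCoins arcsEx (insert 5 {1, 2, 3, 4}) := by
  fin_cases he
  · exact ⟨(1, 0), by decide, by decide⟩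
  · exact ⟨(2, 0), by decide, by decide⟩
  · exact ⟨(3, 0), by decide, by decide⟩
  · exact ⟨(4, 0), by decide, by decide⟩
  · exact ⟨(5, 3), by decide, by decide⟩
  · exact ⟨(5, 4), by decide, by decide⟩

/-- With the four head coins closed, the reduced map has no open arc. -/
lemma no_openArc_ex {ω : Config (Fin 10)} (hω : ∀ r ∈ ({5, 6, 7, 0} : Finset (Fin 8)), ω (hcEx r) = false)
    {x y : Fin 8} (h : OpenArc (coreOff arcsEx (insert 5 {1, 2, 3, 4})) ω x y) : False := by
  obtain ⟨e, he, hxy⟩ := h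
  by_cases hc : e ∈ ({0, 1, 2, 3, 4, 5} : Finset (Fin 10))
  · have := coreCoins_ex e hc
    simp only [coreOff, if_pos this, Finset.notMem_empty] at hxy
  · have hx : ∃ r ∈ ({5, 6, 7, 0} : Finset (Fin 8)), hcEx r = e := by
      have key : ∀ e : Fin 10, e ∉ ({0, 1, 2, 3, 4, 5} : Finset (Fin 10)) →
          ∃ r ∈ ({5, 6, 7, 0} : Finset (Fin 8)), hcEx r = e := by decide
      exact key e hc
    obtain ⟨r, hr, rfl⟩ := hx
    have := hω r hr
    rw [this] at he
    exact Bool.noConfusion he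

/-- The all-closed head avoids `t` from `{r₁, r₂, a, w}` and `s`. -/
lemma allClosed_subset_avoid :
    allClosedK hcEx {5, 6, 7, 0} ⊆
      coreAvoidEvent arcsEx 0 7 (insert 5 {1, 2, 3, 4}) ({3, 4} ∪ {5, 6}) := by
  intro ω hω v hv hreach
  rcases Relation.ReflTransGen.cases_head hreach with hvt | ⟨y, hxy, _⟩
  · subst hvt
    exact absurd hv (by decide)
  · exact no_openArc_ex hω hxy

/-- **The non-degeneracy from the coins**: if the four head coins have probability `< 1`, the head
can be avoided from `{r₁, r₂, a, w}` with positive probability. -/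
lemma hpos_ex {R : Type*} [Field R] [LinearOrder R] [IsStrictOrderedRing R]
    (pr : Fin 10 → R) (hp : IsProbVec pr) (h6 : pr 6 < 1) (h7 : pr 7 < 1) (h8 : pr 8 < 1)
    (h9 : pr 9 < 1) :
    0 < prob pr (coreAvoidEvent arcsEx 0 7 (insert 5 {1, 2, 3, 4}) ({3, 4} ∪ {5, 6})) := by
  refine lt_of_lt_of_le ?_ (prob_mono hp allClosed_subset_avoid)
  rw [prob_allClosedK pr hcEx {5, 6, 7, 0} (by decide)]
  rw [Finset.prod_insert (by decide), Finset.prod_insert (by decide), Finset.prod_insert (by decide),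
    Finset.prod_singleton]
  simp only [hcEx]
  have a6 : 0 < 1 - pr 6 := by linarith
  have a7 : 0 < 1 - pr 7 := by linarith
  have a8 : 0 < 1 - pr 8 := by linarith
  have a9 : 0 < 1 - pr 9 := by linarith
  positivity

/-- **Row 2′DARC at `a → w` for the markers `m₁, m₂`, every probability vector with sure tail
coins and head coins of probability `< 1`.** -/
theorem darc_k2HeadBlind_example' {R : Type*} [Field R] [LinearOrder R] [IsStrictOrderedRing R]
    (pr : Fin 10 → R) (hp : IsProbVec pr) (h4 : pr 4 = 1) (h5 : pr 5 = 1)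
    (h6 : pr 6 < 1) (h7 : pr 7 < 1) (h8 : pr 8 < 1) (h9 : pr 9 < 1) :
    DARC pr arcsEx 0 {7} 1 2 5 6 :=
  darc_k2HeadBlind_example pr hp h4 h5 (hpos_ex pr hp h6 h7 h8 h9)

end K2HeadBlindExample

end Summit.Ventures.PercRepro2.Coin
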